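import Mathlib
import HarnessLib
import Summits.NavierStokesRegularity.NavierStokesRegularity.Theorems.PoloidalWindowDoorLrcModEntireCurvedWebFunction
import Summits.NavierStokesRegularity.NavierStokesRegularity.Theorems.PoloidalWindowDoorLrcModEntireCurvedWebWindow
import Summits.NavierStokesRegularity.NavierStokesRegularity.Theorems.PoloidalWindowDoorLrcModEntireCurvedParallelWebs
import Summits.NavierStokesRegularity.NavierStokesRegularity.Theorems.PoloidalWindowDoorLrcModEntireQ4LimitBranchProper

/-!
# Route `PoloidalWindowDoor`, item `LrcModEntire` (stmt-NavierStokesRegularity-20428), cells (Q4-curved)/(Q4-sonic, curved) of the (TH) column —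
# THE PARALLEL-WEB PACKAGE OVER A CURVED BRANCH (`curved_web_package`: the ¬line analogue of LEAD g16's `…Q4WebPackage.line_web_package`)

Cell ns-regularity-ideate, stub-worker seat ns-poloidal-K2-p2 g16 under the LEAD of item 20428 (ns-poloidal-K2-p3 g16);
`--supports stmt-NavierStokesRegularity-20428 --as helper`.  Memo `Cruxes/LrcModEntire/T2B-g16-sonic.md` §3/§5 («RECOMMENDED NEXT KERNEL STEP: `curved_web_package`»).

From the conjuncts of the (Q4) package of skeleton twist_split (stubs `stub_Q4curved`, `stub_Q4sonicCurved`; hypothesis names of `line_web_package` + the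
re-entry clause `hUcrit`) over an ARBITRARY (`C^∞`, unit-speed, horizontal, hot) limit branch `Γ` — NO line literal — `curved_web_package` exports:
a height window `δ₂ ≤ δ, ρ`; the signed curvature `k` of `Γ` (`Γ″ = k•JΓ′`, differentiable, `|k| ≤ K`); the WEB OFFSET `d` (`C^∞` on `|z| < δ`, `d 0 = 0`) with
★ PARALLEL WEBS: the web function of `…CurvedWebFunction` is `G(s,z) = d(z)` for all `s` and `|z| < δ₂` — the web at height `z` is the parallel curve
`s ↦ Γ s + d(z)·JΓ′ s + z·e₂` of the branch (this seat's `…CurvedParallelWebs.curvedParallelWebs`, its Fermi-factor input `|k(s)d(z)| ≤ 1/2` supplied UNIFORMLY in `s`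
by `…CurvedWebWindow`: curvature bound of the hot branch + uniform smallness of the web function, over the KNSS jet bounds and the ridge law of the hull limit on its
whole hot set `…Q4LimitBranchProper.ridgeLaw_of_limit`); the ridge-law curvature `κf > 0` and HUYGENS `κf(z)·d′(z)² = R″(0,z) − μ(−1,z)·κf(z)` on `(−δ₂, δ₂)` (the same
law as over a straight branch); and at every web point: horizontal criticality of `U₂(−1,·)`, the value `σU₂ = R(0,z)`, strict `JΓ′`-concavity, the ridge law and the
slice law in the moving frame; `R(0,·) ∈ C^∞` on `|z| < δ`.  Consumers: `…CurvedSheetTransport` / `q4sonic_curved_flat_core` (memo §5), the (Q4-curved) CK step.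

WHAT THIS IS NOT: not a claim about Navier–Stokes regularity — structure of a hypothetical object of research cell (Q4); items 20428 / 19708 / 27893 OPEN.
-/

noncomputable section

-- the summit and its single sub-problem share the name (CONVENTIONS §1), as in every Theorems file
set_option linter.dupNamespace false

namespace Summit.NavierStokesRegularity.NavierStokesRegularity.Theorems.PoloidalWindowDoorLrcModEntireCurvedWebPackage

open Set Function Filter Topology Metric
open scoped RealInnerProductSpace InnerProductSpace ContDiff
open Literature.Analysis Literature.Analysis.FluidPDE Literature.Analysis.UnboundedOperators
open Summit.NavierStokesRegularity.NavierStokesRegularity.Theorems.PoloidalWindowDoorLrcModEntireSheetFlattenTools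
open Summit.NavierStokesRegularity.NavierStokesRegularity.Theorems.PoloidalWindowDoorLrcModEntireParallelWebsIdentity
open Summit.NavierStokesRegularity.NavierStokesRegularity.Theorems.PoloidalWindowDoorLrcModEntireParallelWebs
open Summit.NavierStokesRegularity.NavierStokesRegularity.Theorems.LocalSineTubeDoorProfileAlignedWindowRigidityAncient
open Summit.NavierStokesRegularity.NavierStokesRegularity.Theorems.PoloidalWindowDoorLrcModEntireRidgeClass
open Summit.NavierStokesRegularity.NavierStokesRegularity.Theorems.PoloidalWindowDoorLrcModEntireRidgeGlobalBranchODE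
open Summit.NavierStokesRegularity.NavierStokesRegularity.Theorems.PoloidalWindowDoorLrcModEntireRidgeGlobalBranchFrame
open Summit.NavierStokesRegularity.NavierStokesRegularity.Theorems.PoloidalWindowDoorLrcModEntireRidgeGlobalBranchUnique
open Summit.NavierStokesRegularity.NavierStokesRegularity.Theorems.PoloidalWindowDoorLrcModEntirePlanarCurveRigidity
open Summit.NavierStokesRegularity.NavierStokesRegularity.Theorems.PoloidalWindowDoorLrcModEntireQ4LimitBranchProper
open Summit.NavierStokesRegularity.NavierStokesRegularity.Theorems.PoloidalWindowDoorLrcModEntireCurvedWebHuygens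
open Summit.NavierStokesRegularity.NavierStokesRegularity.Theorems.PoloidalWindowDoorLrcModEntireCurvedParallelWebs
open Summit.NavierStokesRegularity.NavierStokesRegularity.Theorems.PoloidalWindowDoorLrcModEntireCurvedWebFunction
open Summit.NavierStokesRegularity.NavierStokesRegularity.Theorems.PoloidalWindowDoorLrcModEntireCurvedWebWindow
open Summit.NavierStokesRegularity.NavierStokesRegularity.Theorems.PoloidalWindowDoorLrcModEntireCurvedWebTools

/-- ★ **THE PARALLEL-WEB PACKAGE OVER A CURVED BRANCH.**  See the module docstring. -/
theorem curved_web_package {C : ℝ} {U : ℝ → EuclideanSpace ℝ (Fin 3) → EuclideanSpace ℝ (Fin 3)} {Γ νΓ : ℝ → EuclideanSpace ℝ (Fin 3)} {R μ : ℝ → ℝ → ℝ}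
    {σ κ r δ ρ : ℝ}
    (hUrate : HasTypeITimeDecay C U) (hUcont : ContinuousOn (uncurry U) (Iio (0 : ℝ) ×ˢ univ))
    (hUmild : ∀ s t : ℝ, s < t → t < 0 → ∀ x, U t x = heatExtension (U s) (t - s) x - oseenDuhamel 1 s U U t x)
    (hUdiv : ∀ t < 0, VectorCalculus.IsDivFree (U t))
    (hUpol : ∀ s < 0, ∀ q, ⟪curl (U s) q, EuclideanSpace.single 2 1⟫_ℝ = 0)
    (hUne : U (-1) 0 2 ≠ 0) (hUhotbd : ∀ t < 0, ∀ x, Real.sqrt (-t) * |U t x 2| ≤ |U (-1) 0 2|)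
    (hUcrit : ∀ y ∈ {y : EuclideanSpace ℝ (Fin 3) | y 2 = 0 ∧ U (-1) y 2 = U (-1) 0 2}, fderiv ℝ (fun x => U (-1) x 2) y = 0)
    (hσ : σ = 1 ∨ σ = -1) (hσN : σ * U (-1) 0 2 = |U (-1) 0 2|) (hκ : 0 < κ)
    (hΓ : ContDiff ℝ ∞ Γ) (hΓ2 : ∀ s, Γ s 2 = 0) (hΓunit : ∀ s, ‖deriv Γ s‖ = 1) (hΓhot : ∀ s, U (-1) (Γ s) 2 = U (-1) 0 2)
    (hν : ∀ s, νΓ s = WithLp.toLp 2 ![-(deriv Γ s 1), deriv Γ s 0, 0])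
    (hΓcurv : ∀ s, κ ≤ -(fderiv ℝ (fderiv ℝ (fun y => σ * U (-1) y 2)) (Γ s) (νΓ s) (νΓ s)))
    (hr : 0 < r) (hδ : 0 < δ)
    (hconc : ∀ τ z : ℝ, |τ| < δ → |z| < δ → ∀ s : ℝ, ∀ n ∈ Ioo (-r) r,
      fderiv ℝ (fderiv ℝ (fun y => σ * U (-1 + τ) y 2)) (Γ s + n • νΓ s + z • EuclideanSpace.single 2 (1 : ℝ)) (νΓ s) (νΓ s) < 0)
    (hweb : ∀ τ₀ z₀ : ℝ, |τ₀| < δ → |z₀| < δ → ∀ s₀ : ℝ, ∃ n₀ ∈ Ioo (-r) r,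
      σ * U (-1 + τ₀) (Γ s₀ + n₀ • νΓ s₀ + z₀ • EuclideanSpace.single 2 (1 : ℝ)) 2 = R τ₀ z₀ ∧
      (∀ n ∈ Icc (-r) r, n ≠ n₀ → σ * U (-1 + τ₀) (Γ s₀ + n • νΓ s₀ + z₀ • EuclideanSpace.single 2 (1 : ℝ)) 2 < R τ₀ z₀) ∧
      DifferentiableAt ℝ (uncurry R) (τ₀, z₀) ∧
      fderiv ℝ (uncurry fun τ y => σ * U (-1 + τ) y 2) (τ₀, Γ s₀ + n₀ • νΓ s₀ + z₀ • EuclideanSpace.single 2 (1 : ℝ)) =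
        (fderiv ℝ (uncurry R) (τ₀, z₀)).comp
          ((ContinuousLinearMap.fst ℝ ℝ (EuclideanSpace ℝ (Fin 3))).prod
            ((EuclideanSpace.proj (2 : Fin 3)).comp (ContinuousLinearMap.snd ℝ ℝ (EuclideanSpace ℝ (Fin 3))))))
    (hρ : 0 < ρ) (hμ3 : ContDiff ℝ 3 (uncurry μ))
    (hslabU : ∀ t : ℝ, |t + 1| < ρ → ∀ x : EuclideanSpace ℝ (Fin 3), |x 2| < ρ → ∀ b : Fin 3, b ≠ 2 →
      fderiv ℝ (U t) x (EuclideanSpace.single 2 1) b = μ t (x 2) * fderiv ℝ (U t) x (EuclideanSpace.single b 1) 2)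
    (hevU : ∀ t₀ : ℝ, |t₀ + 1| < ρ → ∀ y₀ : EuclideanSpace ℝ (Fin 3), y₀ 2 = 0 →
      ∀ᶠ z in 𝓝 ((t₀, y₀) : ℝ × EuclideanSpace ℝ (Fin 3)), ∀ b : Fin 3, b ≠ 2 →
        fderiv ℝ (U z.1) z.2 (EuclideanSpace.single 2 1) b = μ z.1 (z.2 2) * fderiv ℝ (U z.1) z.2 (EuclideanSpace.single b 1) 2) :
    ∃ (δ₂ : ℝ) (d κf k : ℝ → ℝ) (K : ℝ), 0 < δ₂ ∧ δ₂ ≤ δ ∧ δ₂ ≤ ρ ∧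
      -- the branch: Frenet law, differentiable bounded curvature
      (∀ s, deriv (deriv Γ) s = k s • rotJ (deriv Γ s)) ∧ Differentiable ℝ k ∧ (∀ s, |k s| ≤ K) ∧
      -- the web offset and the Fermi factor
      d 0 = 0 ∧ (∀ z : ℝ, |z| < δ → ContDiffAt ℝ ∞ d z) ∧ (∀ z ∈ Ioo (-δ₂) δ₂, d z ∈ Ioo (-r) r ∧ ∀ s, |k s * d z| ≤ 1 / 2) ∧
      -- the height data
      (∀ z : ℝ, |z| < δ → ContDiffAt ℝ ∞ (R 0) z) ∧ (∀ z : ℝ, |z| < δ → DifferentiableAt ℝ κf z) ∧ κ ≤ κf 0 ∧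
      (∀ z ∈ Ioo (-δ₂) δ₂, |z| < δ ∧ |z| < ρ ∧ 0 < κf z ∧ μ (-1) z < 1) ∧
      -- ★ HUYGENS
      (∀ z ∈ Ioo (-δ₂) δ₂, κf z * deriv d z ^ 2 = deriv (deriv (R 0)) z - μ (-1) z * κf z) ∧
      -- ★ PARALLEL WEBS: the unique maximiser of every cross-section at height `z` sits at the offset `d z`
      (∀ s : ℝ, ∀ z ∈ Ioo (-δ₂) δ₂, σ * U (-1) (Γ s + d z • rotJ (deriv Γ s) + z • e2) 2 = R 0 z ∧
        ∀ n ∈ Icc (-r) r, n ≠ d z → σ * U (-1) (Γ s + n • rotJ (deriv Γ s) + z • e2) 2 < R 0 z) ∧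
      -- web points: horizontal criticality, strict normal concavity, ridge law, slice law
      (∀ s : ℝ, ∀ z ∈ Ioo (-δ₂) δ₂, ∀ w : EuclideanSpace ℝ (Fin 3), w 2 = 0 →
        fderiv ℝ (fun y => U (-1) y 2) (Γ s + d z • rotJ (deriv Γ s) + z • e2) w = 0) ∧
      (∀ s : ℝ, ∀ z ∈ Ioo (-δ₂) δ₂,
        fderiv ℝ (fderiv ℝ (fun y => σ * U (-1) y 2)) (Γ s + d z • rotJ (deriv Γ s) + z • e2) (rotJ (deriv Γ s)) (rotJ (deriv Γ s)) < 0) ∧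
      (∀ s : ℝ, ∀ z ∈ Ioo (-δ₂) δ₂,
        fderiv ℝ (fderiv ℝ (fun y => σ * U (-1) y 2)) (Γ s + d z • rotJ (deriv Γ s) + z • e2) (deriv Γ s) (deriv Γ s) +
          fderiv ℝ (fderiv ℝ (fun y => σ * U (-1) y 2)) (Γ s + d z • rotJ (deriv Γ s) + z • e2) (rotJ (deriv Γ s)) (rotJ (deriv Γ s)) = -κf z) ∧
      (∀ s : ℝ, ∀ z ∈ Ioo (-δ₂) δ₂,
        fderiv ℝ (fderiv ℝ (fun y => σ * U (-1) y 2)) (Γ s + d z • rotJ (deriv Γ s) + z • e2) e2 e2 =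
          -μ (-1) z * (fderiv ℝ (fderiv ℝ (fun y => σ * U (-1) y 2)) (Γ s + d z • rotJ (deriv Γ s) + z • e2) (deriv Γ s) (deriv Γ s) +
            fderiv ℝ (fderiv ℝ (fun y => σ * U (-1) y 2)) (Γ s + d z • rotJ (deriv Γ s) + z • e2) (rotJ (deriv Γ s)) (rotJ (deriv Γ s)))) := by
  have hm1 : (-1 : ℝ) < 0 := by norm_num
  have h0δ : |(0 : ℝ)| < δ := by simpa using hδ
  /- STEP A: the web function package over the curved branch. -/
  obtain ⟨δ₁, G, κf, hδ₁, hδ₁δ, hδ₁ρ, hG0, hGr, hGi, hGval, hGuniq, hhoriz, hGconc, hRi, hκfd, hκf0, hI, hridge, hslice⟩ :=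
    curved_web_function hUrate hUcont hUmild hUdiv hUpol hUne hUhotbd hUcrit hσ hσN hκ hΓ hΓ2 hΓunit hΓhot hν hΓcurv hr hδ hconc hweb hρ hμ3
      hslabU hevU
  /- STEP B: the branch — frame, Frenet, curvature. -/
  have hΓ3 : ContDiff ℝ 3 Γ := hΓ.of_le (by norm_cast)
  have hΓc2 : ContDiff ℝ 2 Γ := hΓ.of_le (by norm_cast)
  have hΓd : ∀ t, HasDerivAt Γ (deriv Γ t) t := fun t => (hasDerivAt_of_contDiff_two hΓc2 t).1
  have hT2 : ∀ s, deriv Γ s 2 = 0 := fun s => (deriv_horizontal hΓc2 hΓ2 s).1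
  have hνJ : ∀ s, νΓ s = rotJ (deriv Γ s) := fun s => by rw [hν s]; rfl
  set k : ℝ → ℝ := fun s => ⟪deriv (deriv Γ) s, rotJ (deriv Γ s)⟫ with hk_def
  have hk : ∀ s, deriv (deriv Γ) s = k s • rotJ (deriv Γ s) := fun s => deriv_deriv_eq_curvature_smul hΓc2 hΓ2 hΓunit s
  have hTi : ContDiff ℝ ∞ (deriv Γ) := hΓ.deriv'
  have hT'i : ContDiff ℝ ∞ (deriv (deriv Γ)) := by
    have h : ContDiff ℝ (∞ + 1) (deriv Γ) := by simpa using hTi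
    exact h.deriv'
  have hkd : Differentiable ℝ k := by
    have h1 : Differentiable ℝ (deriv (deriv Γ)) := hT'i.differentiable (by simp)
    have h2 : Differentiable ℝ (fun s => rotJ (deriv Γ s)) := (contDiff_rotJ (n := 1)).differentiable one_ne_zero |>.comp
      (hTi.differentiable (by simp))
    exact h1.inner ℝ h2
  /- STEP C: `F₀`, its jet bounds, the ridge law of the hull limit on its whole hot set, the curvature bound. -/
  set F₀ : EuclideanSpace ℝ (Fin 3) → ℝ := fun y => σ * U (-1) y 2 with hF₀_def
  set M : ℝ := σ * U (-1) 0 2 with hM_def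
  have hσ0 : σ ≠ 0 := by rcases hσ with h | h <;> simp [h]
  have hUan : AnalyticOnNhd ℝ (U (-1)) univ := analyticOnNhd_slice hUcont (bdd_of_hasTypeITimeDecay hUrate) hUmild hm1
  have hUslice : ContDiff ℝ ∞ (U (-1)) := contDiffOn_univ.1 hUan.contDiffOn_of_completeSpace
  have hU2 : ContDiff ℝ 2 (U (-1)) := hUan.contDiff
  have hUd : Differentiable ℝ (U (-1)) := hU2.differentiable (by norm_num)
  have hθan : AnalyticOnNhd ℝ (fun y => U (-1) y 2) univ := fun x _ =>
    ((EuclideanSpace.proj (𝕜 := ℝ) (2 : Fin 3)).analyticAt _).comp (hUan x (mem_univ _))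
  have hθ2 : ContDiff ℝ 2 (fun y => U (-1) y 2) := hθan.contDiff
  have hF₀an : AnalyticOnNhd ℝ F₀ univ := fun x hx => analyticAt_const.mul (hθan x hx)
  have hF₀3 : ContDiff ℝ 3 F₀ := hF₀an.contDiff
  have hF₀2 : ContDiff ℝ 2 F₀ := hF₀an.contDiff
  have hF₀d : Differentiable ℝ F₀ := hF₀2.differentiable (by norm_num)
  have hF₀fd : ∀ x w, fderiv ℝ F₀ x w = σ * fderiv ℝ (fun y => U (-1) y 2) x w := by
    intro x w; rw [hF₀_def, fderiv_const_mul ((hθ2.differentiable (by norm_num)) x)]; simp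
  have hwdiv : ∀ t < 0, IsWeaklyDivFree (U t) := fun t ht =>
    VectorCalculus.IsDivFree.isWeaklyDivFree_holds (hUdiv t ht)
      ((contDiffOn_univ.1 (analyticOnNhd_slice hUcont (bdd_of_hasTypeITimeDecay hUrate) hUmild ht).contDiffOn_of_completeSpace).of_le
        (by exact WithTop.coe_le_coe.2 le_top))
  have hbound : ∀ j : ℕ, ∃ Cj : ℝ, ∀ x, ‖iteratedFDeriv ℝ j F₀ x‖ ≤ Cj := fun j => by
    obtain ⟨Kj, hKj⟩ := exists_norm_iteratedFDeriv_le_slice_of_hasTypeITimeDecay hUrate hUcont hUmild hwdiv hm1 j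
    exact ⟨Kj, fun x => (norm_iteratedFDeriv_signed_le hUslice hσ j x).trans (hKj x)⟩
  obtain ⟨C₂, hC₂⟩ := hbound 2
  obtain ⟨C₃, hC₃⟩ := hbound 3
  have hhot_iff : ∀ y : EuclideanSpace ℝ (Fin 3), F₀ y = M ↔ U (-1) y 2 = U (-1) 0 2 := fun y => by
    simp only [hF₀_def, hM_def]; exact mul_right_inj' hσ0
  have hcritf : ∀ y : EuclideanSpace ℝ (Fin 3), y 2 = 0 → F₀ y = M → fderiv ℝ F₀ y = 0 := by
    intro y hy2 hyM
    have h := hUcrit y ⟨hy2, (hhot_iff y).1 hyM⟩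
    have e : F₀ = fun x => σ * (fun x => U (-1) x 2) x := rfl
    rw [e, fderiv_const_mul ((hθ2.differentiable (by norm_num)) y), h, smul_zero]
  have hhotf : ∀ s, F₀ (Γ s) = M := fun s => (hhot_iff _).2 (hΓhot s)
  obtain ⟨κ', hκκ', htr⟩ := ridgeLaw_of_limit hUrate hUcont hUmild hUdiv hUpol hUne hUhotbd hUcrit hσ hΓc2 hΓ2 hΓunit hΓhot hν hΓcurv hρ hμ3 hevU
  have hκ'pos : 0 < κ' := lt_of_lt_of_le hκ hκκ'
  have hκ' : κ' ≠ 0 := hκ'pos.ne'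
  -- exact normal curvature along `Γ`: `D²F₀(Γ s)[JΓ′,JΓ′] = −κ'`
  have hkerΓ : ∀ s w, fderiv ℝ (fderiv ℝ F₀) (Γ s) (deriv Γ s) w = 0 := fun s w =>
    hessian_apply_deriv_eq_zero_of_hot hF₀2 hcritf (hΓd s) hΓ2 hhotf w
  have hcurvΓ : ∀ s, fderiv ℝ (fderiv ℝ F₀) (Γ s) (rotJ (deriv Γ s)) (rotJ (deriv Γ s)) = -κ' := by
    intro s
    have h := htr (Γ s) (hΓ2 s) (hhotf s)
    rw [← frame_trace (fderiv ℝ (fderiv ℝ F₀) (Γ s)) (hT2 s) (hΓunit s), hkerΓ s, zero_add] at h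
    exact h
  have hcritΓ : ∀ s, fderiv ℝ F₀ (Γ s) (rotJ (deriv Γ s)) = 0 := fun s => by
    rw [hcritf (Γ s) (hΓ2 s) (hhotf s)]; rfl
  -- curvature bound
  set K : ℝ := κ'⁻¹ ^ 2 * (4 * (C₃ * C₂)) with hK_def
  have hkK : ∀ s, |k s| ≤ K := fun s =>
    abs_curvature_le_of_hotCurve hF₀an hC₂ hC₃ hκ' hcritf htr hΓc2 hΓ2 hhotf hΓunit hk s
  have hK0 : 0 ≤ K := (abs_nonneg _).trans (hkK 0)
  /- STEP D: the uniform window — `|G| < ρ₀`, `|k G| ≤ 1/2`. -/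
  set C₂' : ℝ := max C₂ 1 with hC₂'
  set C₃' : ℝ := max C₃ 1 with hC₃'
  have hC₂'pos : 0 < C₂' := lt_of_lt_of_le one_pos (le_max_right _ _)
  have hC₃'pos : 0 < C₃' := lt_of_lt_of_le one_pos (le_max_right _ _)
  have hC₂'b : ∀ x, ‖iteratedFDeriv ℝ 2 F₀ x‖ ≤ C₂' := fun x => (hC₂ x).trans (le_max_left _ _)
  have hC₃'b : ∀ x, ‖iteratedFDeriv ℝ 3 F₀ x‖ ≤ C₃' := fun x => (hC₃ x).trans (le_max_left _ _)
  set ρ₀ : ℝ := min (κ' / (4 * C₃')) (1 / (2 * (K + 1))) with hρ₀_def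
  have hρ₀pos : 0 < ρ₀ := lt_min (by positivity) (by positivity)
  have hρ₀a : ρ₀ ≤ κ' / (4 * C₃') := min_le_left _ _
  have hρ₀b : ρ₀ ≤ 1 / (2 * (K + 1)) := min_le_right _ _
  set δ₂ : ℝ := min δ₁ (min (κ' / (4 * C₃')) (κ' * ρ₀ / (4 * C₂'))) with hδ₂_def
  have hδ₂ : 0 < δ₂ := lt_min hδ₁ (lt_min (by positivity) (by positivity))
  have hδ₂δ₁ : δ₂ ≤ δ₁ := min_le_left _ _
  have hI2 : Ioo (-δ₂) δ₂ ⊆ Ioo (-δ₁) δ₁ := fun z hz => ⟨by linarith [hz.1, hδ₂δ₁], lt_of_lt_of_le hz.2 hδ₂δ₁⟩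
  have hsmall : ∀ p ∈ region (Ioo (-δ₂) δ₂), |G p| < ρ₀ := by
    intro p hp
    have hz : |p.2| < δ₂ := abs_lt.2 hp
    have hzδ : |p.2| < δ := (hI p.2 (hI2 hp)).1
    have hz1 : |p.2| < κ' / (4 * C₃') := lt_of_lt_of_le hz ((min_le_right _ _).trans (min_le_left _ _))
    have hz2 : |p.2| < κ' * ρ₀ / (4 * C₂') := lt_of_lt_of_le hz ((min_le_right _ _).trans (min_le_right _ _))
    have h1 : C₃' * (ρ₀ + |p.2|) ≤ κ' / 2 := by
      have ha : C₃' * ρ₀ ≤ κ' / 4 := by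
        calc C₃' * ρ₀ ≤ C₃' * (κ' / (4 * C₃')) := mul_le_mul_of_nonneg_left hρ₀a hC₃'pos.le
          _ = κ' / 4 := by field_simp
      have hb : C₃' * |p.2| ≤ κ' / 4 := by
        have := mul_le_mul_of_nonneg_left hz1.le hC₃'pos.le
        calc C₃' * |p.2| ≤ C₃' * (κ' / (4 * C₃')) := this
          _ = κ' / 4 := by field_simp
      linarith
    have h2 : C₂' * |p.2| < κ' * ρ₀ / 2 := by
      calc C₂' * |p.2| < C₂' * (κ' * ρ₀ / (4 * C₂')) := mul_lt_mul_of_pos_left hz2 hC₂'pos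
        _ = κ' * ρ₀ / 4 := by field_simp
        _ < κ' * ρ₀ / 2 := by
            have : 0 < κ' * ρ₀ := mul_pos hκ'pos hρ₀pos
            linarith
    have hconcF : ∀ n ∈ Ioo (-r) r, fderiv ℝ (fderiv ℝ F₀) (Γ p.1 + n • rotJ (deriv Γ p.1) + p.2 • e2) (rotJ (deriv Γ p.1)) (rotJ (deriv Γ p.1)) < 0 := by
      intro n hn
      have h := hconc 0 p.2 h0δ hzδ p.1 n hn
      simp only [add_zero] at h
      rw [hνJ] at h
      exact h
    have hGcrit : fderiv ℝ F₀ (Γ p.1 + G p • rotJ (deriv Γ p.1) + p.2 • e2) (rotJ (deriv Γ p.1)) = 0 := by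
      rw [hF₀fd, hhoriz p hzδ (rotJ (deriv Γ p.1)) (rotJ_facts (hT2 p.1) (hΓunit p.1)).1, mul_zero]
    exact abs_critical_lt_of_concave hF₀3 hC₂'b hC₃'b (rotJ_facts (hT2 p.1) (hΓunit p.1)).2.1 (by simp [e2]) hρ₀pos (hcritΓ p.1)
      (hcurvΓ p.1) hconcF (hGr p hzδ) hGcrit h1 h2
  have hJhalf : ∀ p ∈ region (Ioo (-δ₂) δ₂), |k p.1 * G p| ≤ 1 / 2 := by
    intro p hp
    have h1 := hkK p.1
    have h2 := (hsmall p hp).le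
    rw [abs_mul]
    calc |k p.1| * |G p| ≤ K * ρ₀ := mul_le_mul h1 h2 (abs_nonneg _) hK0
      _ ≤ K * (1 / (2 * (K + 1))) := mul_le_mul_of_nonneg_left hρ₀b hK0
      _ ≤ 1 / 2 := by
          rw [mul_one_div, div_le_iff₀ (by positivity)]
          linarith
  have hJ : ∀ p ∈ region (Ioo (-δ₂) δ₂), 1 - k p.1 * G p ≠ 0 := by
    intro p hp h0
    have h := hJhalf p hp
    have : k p.1 * G p = 1 := by linarith
    rw [this] at h
    norm_num at h
  /- STEP E: PARALLEL WEBS on `ℝ × (−δ₂, δ₂)`. -/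
  have habs : ∀ z : ℝ, z ∈ Ioo (-δ) δ ↔ |z| < δ := fun z => by rw [mem_Ioo, abs_lt]
  have hIδ : ∀ z ∈ Ioo (-δ₂) δ₂, |z| < δ := fun z hz => (hI z (hI2 hz)).1
  have hG2 : ContDiffOn ℝ 2 G (region (Ioo (-δ₂) δ₂)) := fun p hp => ((hGi p (hIδ p.2 hp)).of_le (by norm_cast)).contDiffWithinAt
  have hRon : ContDiffOn ℝ ∞ (R 0) (Ioo (-δ) δ) := fun z hz => (hRi z ((habs z).1 hz)).contDiffWithinAt
  have hR1on : ContDiffOn ℝ 2 (deriv (R 0)) (Ioo (-δ) δ) :=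
    ((contDiffOn_succ_iff_deriv_of_isOpen isOpen_Ioo).1 (hRon.of_le (m := 2 + 1) (by norm_cast))).2.2
  have hR2on : ContDiffOn ℝ 1 (deriv (deriv (R 0))) (Ioo (-δ) δ) :=
    ((contDiffOn_succ_iff_deriv_of_isOpen isOpen_Ioo).1 (hR1on.of_le (m := 1 + 1) (by norm_num))).2.2
  have hRd : ∀ z ∈ Ioo (-δ) δ, DifferentiableAt ℝ (R 0) z := fun z hz => (hRi z ((habs z).1 hz)).differentiableAt (by simp)
  have hR'd : ∀ z ∈ Ioo (-δ) δ, DifferentiableAt ℝ (deriv (R 0)) z := fun z hz =>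
    ((hR1on.differentiableOn (by norm_num)) z hz).differentiableAt (isOpen_Ioo.mem_nhds hz)
  have hR''d : ∀ z ∈ Ioo (-δ) δ, DifferentiableAt ℝ (deriv (deriv (R 0))) z := fun z hz =>
    ((hR2on.differentiableOn (by norm_num)) z hz).differentiableAt (isOpen_Ioo.mem_nhds hz)
  have hIδ' : Ioo (-δ₂) δ₂ ⊆ Ioo (-δ) δ := fun z hz => (habs z).2 (hIδ z hz)
  have hμfun : μ (-1) = uncurry μ ∘ fun z : ℝ => ((-1 : ℝ), z) := by funext z; rfl
  have hμd : ∀ z : ℝ, DifferentiableAt ℝ (μ (-1)) z := fun z => by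
    rw [hμfun]; exact ((hμ3.differentiable (by norm_num)) _).comp z ((differentiableAt_const _).prodMk differentiableAt_id)
  have hpar : ∀ s : ℝ, ∀ z ∈ Ioo (-δ₂) δ₂, G (s, z) = G (0, z) :=
    curvedParallelWebs hF₀3 hΓc2 hΓ2 hk hkd hδ₂ hG2 (R := R 0) (κ := κf) (μ := μ (-1))
      (fun z hz => (hR'd z (hIδ' hz)).hasDerivAt) (fun z hz => hRd z (hIδ' hz))
      (fun z hz => (hI z (hI2 hz)).2.2.1) (fun z hz => hκfd z (hIδ z hz))
      (fun z hz => (hR''d z (hIδ' hz)).sub ((hμd z).mul (hκfd z (hIδ z hz)))) hJ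
      (fun p hp => by rw [hF₀fd, hhoriz p (hIδ p.2 hp) _ (rotJ_facts (hT2 p.1) (hΓunit p.1)).1, mul_zero])
      (fun p hp => by rw [hF₀fd, hhoriz p (hIδ p.2 hp) _ (hT2 p.1), mul_zero])
      (fun p hp => hGval p (hIδ p.2 hp)) (fun p hp => hridge p (hI2 hp)) (fun p hp => hslice p (hI2 hp)) hG0
  /- STEP F: the web offset `d`, Huygens. -/
  set d : ℝ → ℝ := fun z => G (0, z) with hd_def
  have hdi : ∀ z : ℝ, |z| < δ → ContDiffAt ℝ ∞ d z := fun z hz =>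
    (hGi ((0 : ℝ), z) hz).comp z (contDiffAt_const.prodMk contDiffAt_id)
  have hGd : ∀ p ∈ region (Ioo (-δ₂) δ₂), DifferentiableAt ℝ G p := fun p hp => (hGi p (hIδ p.2 hp)).differentiableAt (by simp)
  have hhuy : ∀ z ∈ Ioo (-δ₂) δ₂, κf z * deriv d z ^ 2 = deriv (deriv (R 0)) z - μ (-1) z * κf z := by
    intro z hz
    have hp : ((0 : ℝ), z) ∈ region (Ioo (-δ₂) δ₂) := hz
    have hid := curved_huygens_identity hF₀3 hΓc2 hΓ2 hk isOpen_Ioo hGd (R := R 0) (κ := κf) (μ := μ (-1))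
      (fun z hz => (hR'd z (hIδ' hz)).hasDerivAt) (fun z hz => hRd z (hIδ' hz))
      (fun p hp => by rw [hF₀fd, hhoriz p (hIδ p.2 hp) _ (rotJ_facts (hT2 p.1) (hΓunit p.1)).1, mul_zero])
      (fun p hp => by rw [hF₀fd, hhoriz p (hIδ p.2 hp) _ (hT2 p.1), mul_zero])
      (fun p hp => hGval p (hIδ p.2 hp)) (fun p hp => hridge p (hI2 hp)) (fun p hp => hslice p (hI2 hp)) hp
    -- `∂_sG(0,z) = 0` by parallel webs, `∂_zG(0,z) = d′(z)`
    have hGdp : DifferentiableAt ℝ G ((0 : ℝ), z) := hGd ((0 : ℝ), z) hp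
    have hGs : fderiv ℝ G ((0 : ℝ), z) (1, 0) = 0 := by
      rw [fderiv_apply_one_zero_eq_deriv hGdp]
      have : (fun s : ℝ => G (s, ((0 : ℝ), z).2)) = fun _ => G (0, z) := funext fun s => hpar s z hz
      rw [this, deriv_const]
    have hGz : fderiv ℝ G ((0 : ℝ), z) (0, 1) = deriv d z := by
      rw [fderiv_apply_zero_one_eq_deriv hGdp]
    have hJz0 : 1 - k 0 * G (0, z) ≠ 0 := hJ ((0 : ℝ), z) hp
    have hJz : (1 - k 0 * G (0, z)) ^ 2 ≠ 0 := pow_ne_zero 2 hJz0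
    rw [hGs, hGz] at hid
    simp only [zero_pow two_ne_zero, add_zero] at hid
    -- `κ J² d′² = c J²`
    have hc : κf z * deriv d z ^ 2 * (1 - k 0 * G (0, z)) ^ 2 =
        (deriv (deriv (R 0)) z - μ (-1) z * κf z) * (1 - k 0 * G (0, z)) ^ 2 := by linear_combination hid
    have := mul_right_cancel₀ hJz hc
    linear_combination this
  /- ASSEMBLE. -/
  refine ⟨δ₂, d, κf, k, K, hδ₂, hδ₂δ₁.trans hδ₁δ, hδ₂δ₁.trans hδ₁ρ, hk, hkd, hkK, hG0 0, hdi, fun z hz => ⟨hGr ((0 : ℝ), z) (hIδ z hz), fun s => ?_⟩,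
    hRi, hκfd, hκf0, fun z hz => hI z (hI2 hz), hhuy, fun s z hz => ?_, fun s z hz w hw => ?_, fun s z hz => ?_, fun s z hz => ?_, fun s z hz => ?_⟩
  · have h := hJhalf (s, z) hz; rw [hpar s z hz] at h; exact h
  · have h1 := hGval (s, z) (hIδ z hz); have h2 := hGuniq (s, z) (hIδ z hz)
    rw [hpar s z hz] at h1 h2; exact ⟨h1, h2⟩
  · have h := hhoriz (s, z) (hIδ z hz) w hw; rw [hpar s z hz] at h; exact h
  · have h := hGconc (s, z) (hIδ z hz); rw [hpar s z hz] at h; exact h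
  · have h := hridge (s, z) (hI2 hz); rw [hpar s z hz] at h; exact h
  · have h := hslice (s, z) (hI2 hz); rw [hpar s z hz] at h; exact h

end Summit.NavierStokesRegularity.NavierStokesRegularity.Theorems.PoloidalWindowDoorLrcModEntireCurvedWebPackage
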